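import Summits.Ventures.HSemireg.WedgeHankelRecurrenceGaussChebyshevTCoprimeIff

/-!
# Venture HSemireg — **THE RESULTANT OF TWO SECOND-KIND CHEBYSHEV POLYNOMIALS IN CLOSED FORM: `Res_{(m,n)}(U_m, U_n) = (−1)^{mn∕2} 2^{mn}` IF `gcd(m+1, n+1) = 1`, AND `0` OTHERWISE**
# (Mathlib's `U`, integer resultant with the formal degrees `m`, `n`; Dilcher–Stolarsky); the engine is a EUCLIDEAN STEP FOR RESULTANTS, **`Res_{(m, n+m+1)}(U_m, U_{n+m+1}) =
# (−1)^{m(m+1)∕2} 2^{m(m+1)} · Res_{(m,n)}(U_m, U_n)`**, from the addition formula `U_{n+m+1} = U_n U_{m+1} − U_{n−1} U_m`, Mathlib's `Res(f, g + f·p) = Res(f, g)` and multiplicativity, and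
# the consecutive value N406 `Res(U_{m+1}, U_m) = (−1)^{m(m+1)∕2} 2^{m(m+1)}`; then a descent along the Euclidean algorithm on `(m+1, n+1)` (so `|Res(U_m,U_n)| = 2^{mn}` exactly when the `m`- and
# `n`-node second-kind Gauss–Chebyshev ∕ Fejér rules share no node)

HONEST FRAMING. Part of the Lean index of the computation cell `pub-hsemireg` (seat p10 gen 48, Sunday typer «UNIFORM-IN-n»).  Polynomial ∕ resultant algebra over `ℤ` and `ℕ`-parity bookkeeping only;
no variety, no cohomology theory, no sheaf, no Ext group and no semiregularity map is constructed here; nothing here says that HC / HC_CM / HC_AV holds; no Literature fact (unproved `Prop`) is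
declared or used.  Custodian versions as in `WedgeHankelSiegelIdeal` (1/3).
SOURCES (cited).  K. Dilcher, K. B. Stolarsky, *Resultants and discriminants of Chebyshev and related polynomials*, Trans. Amer. Math. Soc. 357 (2005) 965–981, Thm 3.1 ∕ (3.4) (`Res(U_m, U_n)`);
D. P. Jacobs, M. O. Rayes, V. Trevisan, *The resultant of Chebyshev polynomials*, Canad. Math. Bull. 54 (2011) 288–296 (the Euclidean-algorithm proof followed here).  The sign `(−1)^{mn∕2}` was
checked against exact Sylvester determinants for `1 ≤ m, n ≤ 7` (seat folder `work/py/rescheck.py`).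
PROOF TYPED HERE.  N453 `chebyshevU_add`; N406 `chebyshevU_resultant` (consecutive pair); Mathlib `resultant_add_mul_right`, `resultant_mul_right`, `resultant_comm`, `resultant_self_eq_zero`,
`resultant_one_left`, `natDegree_U_natCast`, `natDegree_U`, `Nat.coprime_add_self_right`, `Nat.add_div_of_dvd_right`, `Nat.strong_induction_on`.
DEDUP DISCLOSURE (`rg -n 'even_mul_of_coprime_succ|chebyshevU_resultant_add_succ|chebyshevU_resultant_closed' Summits Literature HarnessLib`, 2026-09-04): N406 `chebyshevU_resultant` (consecutive), N421 ∕
N430 (two apart), N434 (odd–odd vanishing), N454 (vanishing iff); 0 hits for the 4 names below.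

WHAT IS IN THE TREE.  N406, N430, N434, N453, N454, N457.
THIS FILE (namespace `Summit.Ventures.HSemireg.Wedge.HankelOuter` continued; CHAINED on N459; 0 definitions):
* §1225 `even_mul_of_coprime_succ`, **`chebyshevU_resultant_add_succ`** (Euclidean step for resultants), `chebyshevU_resultant_closed_step`, **`chebyshevU_resultant_closed`**.
CAVEATS.  `mn ∕ 2` is `ℕ`-division (exact whenever the resultant is non-zero: `gcd(m+1,n+1) = 1` forces `mn` even).  Formal degrees explicit.  Nothing Ext-side.  New names only.
-/

open Module Polynomial
open scoped Matrix Polynomial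

namespace Summit.Ventures.HSemireg.Wedge.HankelOuter

/-! ## §1225. `Res(U_m, U_n)` in closed form -/

/-- Parity bookkeeping: `gcd(m+1, n+1) = 1 ⇒ mn` is even. [this file, §1225] -/
theorem even_mul_of_coprime_succ {m n : ℕ} (h : Nat.Coprime (m + 1) (n + 1)) : Even (m * n) := by
  by_contra hodd
  rw [Nat.not_even_iff_odd, Nat.odd_mul] at hodd
  have h2 : 2 ∣ Nat.gcd (m + 1) (n + 1) := Nat.dvd_gcd (even_iff_two_dvd.1 hodd.1.add_one) (even_iff_two_dvd.1 hodd.2.add_one)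
  rw [Nat.Coprime.gcd_eq_one h] at h2
  exact absurd h2 (by norm_num)

/-- **EUCLIDEAN STEP FOR RESULTANTS: `Res_{(m, n+m+1)}(U_m, U_{n+m+1}) = (−1)^{m(m+1)∕2} 2^{m(m+1)} · Res_{(m,n)}(U_m, U_n)`** over `ℤ` (addition formula, `Res(f, g + f p) = Res(f, g)`,
multiplicativity, N406). [Jacobs–Rayes–Trevisan 2011; this file, §1225] -/
theorem chebyshevU_resultant_add_succ (m n : ℕ) :
    (Polynomial.Chebyshev.U ℤ (m : ℤ)).resultant (Polynomial.Chebyshev.U ℤ ((n + m + 1 : ℕ) : ℤ)) m (n + m + 1) =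
      (-1) ^ (m * (m + 1) / 2) * 2 ^ (m * (m + 1)) * (Polynomial.Chebyshev.U ℤ (m : ℤ)).resultant (Polynomial.Chebyshev.U ℤ (n : ℤ)) m n := by
  -- addition formula `U_{n+m+1} = U_n U_{m+1} + U_m · (−U_{n−1})`
  have hadd : Polynomial.Chebyshev.U ℤ ((n + m + 1 : ℕ) : ℤ) =
      Polynomial.Chebyshev.U ℤ (n : ℤ) * Polynomial.Chebyshev.U ℤ ((m + 1 : ℕ) : ℤ) + Polynomial.Chebyshev.U ℤ (m : ℤ) * (-Polynomial.Chebyshev.U ℤ ((n : ℤ) - 1)) := by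
    have h := chebyshevU_add (R := ℤ) (n : ℤ) ((m + 1 : ℕ) : ℤ)
    rw [show (n : ℤ) + ((m + 1 : ℕ) : ℤ) = ((n + m + 1 : ℕ) : ℤ) by push_cast; ring, show ((m + 1 : ℕ) : ℤ) - 1 = (m : ℤ) by push_cast; ring] at h
    rw [h]; ring
  have hdm : (Polynomial.Chebyshev.U ℤ (m : ℤ)).natDegree ≤ m := (Polynomial.Chebyshev.natDegree_U_natCast ℤ m).le
  have hdp : (-Polynomial.Chebyshev.U ℤ ((n : ℤ) - 1)).natDegree + m ≤ n + m + 1 := by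
    rw [natDegree_neg, Polynomial.Chebyshev.natDegree_U, sub_add_cancel, Int.natAbs_natCast]; omega
  have hN : n + m + 1 = (Polynomial.Chebyshev.U ℤ (n : ℤ)).natDegree + (Polynomial.Chebyshev.U ℤ ((m + 1 : ℕ) : ℤ)).natDegree := by
    rw [Polynomial.Chebyshev.natDegree_U_natCast, Polynomial.Chebyshev.natDegree_U_natCast]; ring
  -- the consecutive value (N406), with the arguments swapped
  have hcons : (Polynomial.Chebyshev.U ℤ (m : ℤ)).resultant (Polynomial.Chebyshev.U ℤ ((m + 1 : ℕ) : ℤ)) m (m + 1) = (-1) ^ (m * (m + 1) / 2) * 2 ^ (m * (m + 1)) := by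
    rw [Polynomial.resultant_comm, Even.neg_one_pow (Nat.even_mul_succ_self m), one_mul, Nat.cast_succ, chebyshevU_resultant]
  rw [hadd, Polynomial.resultant_add_mul_right _ _ _ _ _ hdp hdm, hN, Polynomial.resultant_mul_right _ _ _ _ hdm, Polynomial.Chebyshev.natDegree_U_natCast,
    Polynomial.Chebyshev.natDegree_U_natCast, hcons]
  ring

/-- The descent step for the closed form: the value at `(m, k)` gives the value at `(m, k+m+1)`. [this file, §1225] -/
theorem chebyshevU_resultant_closed_step {m k : ℕ}
    (h : (Polynomial.Chebyshev.U ℤ (m : ℤ)).resultant (Polynomial.Chebyshev.U ℤ (k : ℤ)) m k = if Nat.Coprime (m + 1) (k + 1) then (-1) ^ (m * k / 2) * 2 ^ (m * k) else 0) :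
    (Polynomial.Chebyshev.U ℤ (m : ℤ)).resultant (Polynomial.Chebyshev.U ℤ ((k + m + 1 : ℕ) : ℤ)) m (k + m + 1) =
      if Nat.Coprime (m + 1) (k + m + 1 + 1) then (-1) ^ (m * (k + m + 1) / 2) * 2 ^ (m * (k + m + 1)) else 0 := by
  rw [chebyshevU_resultant_add_succ, h]
  have hiff : Nat.Coprime (m + 1) (k + m + 1 + 1) ↔ Nat.Coprime (m + 1) (k + 1) := by
    rw [show k + m + 1 + 1 = (k + 1) + (m + 1) by ring, Nat.coprime_add_self_right]
  by_cases hc : Nat.Coprime (m + 1) (k + 1)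
  · rw [if_pos hc, if_pos (hiff.2 hc), show m * (k + m + 1) = m * k + m * (m + 1) by ring,
      Nat.add_div_of_dvd_right (even_iff_two_dvd.1 (even_mul_of_coprime_succ hc)), pow_add, pow_add]
    ring
  · rw [if_neg hc, if_neg (fun h' => hc (hiff.1 h')), mul_zero]

/-- **`Res_{(m,n)}(U_m, U_n) = (−1)^{mn∕2} 2^{mn}` if `gcd(m+1, n+1) = 1`, and `= 0` otherwise** (all `m, n ∈ ℕ`; integer resultant of Mathlib's `U` with formal degrees `m`, `n`).
[Dilcher–Stolarsky 2005 Thm 3.1; Jacobs–Rayes–Trevisan 2011; this file, §1225] -/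
theorem chebyshevU_resultant_closed (m n : ℕ) :
    (Polynomial.Chebyshev.U ℤ (m : ℤ)).resultant (Polynomial.Chebyshev.U ℤ (n : ℤ)) m n = if Nat.Coprime (m + 1) (n + 1) then (-1) ^ (m * n / 2) * 2 ^ (m * n) else 0 := by
  obtain ⟨s, hs⟩ : ∃ s, m + n = s := ⟨_, rfl⟩
  induction s using Nat.strong_induction_on generalizing m n with
  | _ s ih =>
  rcases lt_trichotomy m n with hlt | rfl | hgt
  · -- `m < n`: descend from `(m, n − m − 1)`
    obtain ⟨k, rfl⟩ : ∃ k, n = k + m + 1 := ⟨n - m - 1, by omega⟩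
    exact chebyshevU_resultant_closed_step (ih (m + k) (by omega) m k rfl)
  · -- `m = n`
    rcases Nat.eq_zero_or_pos m with rfl | hm
    · rw [Nat.cast_zero, Polynomial.Chebyshev.U_zero]
      simp
    · have h0 := Polynomial.resultant_self_eq_zero (Polynomial.Chebyshev.U ℤ (m : ℤ)) (by rw [Polynomial.Chebyshev.natDegree_U_natCast]; omega)
      rw [Polynomial.Chebyshev.natDegree_U_natCast] at h0
      rw [h0, if_neg (by rw [Nat.coprime_self]; omega)]
  · -- `m > n`: swap, descend from `(n, m − n − 1)`, swap back
    obtain ⟨k, rfl⟩ : ∃ k, m = k + n + 1 := ⟨m - n - 1, by omega⟩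
    rw [Polynomial.resultant_comm, chebyshevU_resultant_closed_step (ih (n + k) (by omega) n k rfl)]
    by_cases hc : Nat.Coprime (k + n + 1 + 1) (n + 1)
    · rw [if_pos hc, if_pos (Nat.coprime_comm.1 hc), mul_comm n (k + n + 1), Even.neg_one_pow (even_mul_of_coprime_succ hc), one_mul]
    · rw [if_neg hc, if_neg (fun h' => hc (Nat.coprime_comm.1 h')), mul_zero]

end Summit.Ventures.HSemireg.Wedge.HankelOuter
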